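import Literature.NumberTheory.LFunctions.MertensErrorTermsMeanValueRHSufficiency
import HarnessLib

/-!
# RH-EQUIVALENT literature, proof layer — «nothing here bears on the truth of RH»
# Zhao 2025, Corollary 1 for `i = 1` PROVED: under RH, `∫_{cX}^X E₁(x) dx > 0` for all large `X`, every `0 < c < ((2−B₁)/(2+B₁))²`

Proof companion of `MertensErrorTermsMeanValueRH.lean` (T. Zhao, Res. Number Theory 11 (2025) 62 =
arXiv:2411.18903 [bib: `Zhao2025MertensMean`]); theorems only, no definition, no named fact. The source's Corollary 1
(RH-CONDITIONAL): «Assuming RH, for each `i ∈ {1, 2, 3}` and any positive constant `c < ((2−B₁)/(2+B₁))² = 0.9118…`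
we have `∫_{cX}^X E_i(x) dx > 0` for all sufficiently large `X`», `B₁ = Σ_ρ 1/|ρ|² = 2 + γ − log 4π = 0.0461…` ((2.3),
the tree's `nicolasBeta`). This file PROVES the case `i = 1` (`Zhao2025.cor1_E₁_of_RH`, with the printed threshold and
the printed `B₁`), i.e. the first conjunct of the named fact `Zhao2025MertensMean_cor1`; `i = 2, 3` are not done.

The printed argument: by (2.1), `∫_{cX}^X E₁ = cX·T(cX) − X·T(X)`, `T(y) = ∫_y^∞ (θ − t)/t²`; under RH the explicit formula
(the tree's Rosser–Schoenfeld Lemma 7 in exact form, `PsiTailIntegral.integral_Ioi_psi_sub_self_div_sq_le` /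
`neg_integral_Ioi_psi_sub_self_div_sq_le`, with `K(y) = B₁/√y`, `Zhao2025.rsK_eq_of_RH`) and `ψ − θ ∼ √x` give
`−X T(X) ≥ (2 − B₁ − o(1))√X` and `cX T(cX) ≥ −(2 + B₁ + o(1))√(cX)`, whence positivity as soon as
`(2 − B₁) > (2 + B₁)√c`. The source uses `ψ − θ > 0.98√x` / `< 1.02√x`-type explicit bounds; here `ψ − θ ≥ (1 − ε)√x` and
`≤ (1 + ε)√x` for large `x` are derived from Mathlib's `Chebyshev.psi_sub_theta_ge_psi_add_psi_add_psi`,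
`psi_sub_theta_le_psi_add_psi_add_psi` and the prime number theorem for `θ` (`Mertens.exists_abs_theta_sub_le_div_log_pow`).
-/

noncomputable section

open Filter Topology Set MeasureTheory
open scoped Real Chebyshev

namespace Literature.NumberTheory.LFunctions

namespace Zhao2025

open PsiTailIntegral NicolasJExplicit

/-! ### `ψ − θ ∼ √x`, two-sided eventual form -/

/-- `√x → ∞`. [cite: Zhao2025MertensMean, §2 (proof of Cor 1)] -/
theorem tendsto_sqrt_atTop : Tendsto (fun x : ℝ => Real.sqrt x) atTop atTop := by
  have : (fun X : ℝ => Real.sqrt X) = fun X => X ^ (1 / 2 : ℝ) := funext fun X => Real.sqrt_eq_rpow X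
  rw [this]
  exact tendsto_rpow_atTop (by norm_num)

/-- `ψ(t) − θ(t) ≥ (1 − ε)√t` for all large `t` (`ψ − θ ≥ θ(√t)` and the prime number theorem at `√t`); the source's
(2.2) `ψ − θ > 0.98√x`. [cite: Zhao2025MertensMean, §2 (2.2)] -/
theorem eventually_le_psi_sub_theta {ε : ℝ} (hε : 0 < ε) :
    ∀ᶠ t : ℝ in atTop, (1 - ε) * Real.sqrt t ≤ ψ t - θ t := by
  obtain ⟨C, hC0, hC⟩ := Mertens.exists_abs_theta_sub_le_div_log_pow 1
  have h1 : ∀ᶠ t : ℝ in atTop, 2 ≤ Real.sqrt t := tendsto_sqrt_atTop.eventually_ge_atTop 2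
  have h2 : ∀ᶠ t : ℝ in atTop, C / ε ≤ Real.log (Real.sqrt t) :=
    (Real.tendsto_log_atTop.comp tendsto_sqrt_atTop).eventually_ge_atTop (C / ε)
  filter_upwards [h1, h2, eventually_ge_atTop (0 : ℝ)] with t ht1 ht2 ht0
  have hlogpos : 0 < Real.log (Real.sqrt t) := Real.log_pos (by linarith)
  have hs0 : 0 ≤ Real.sqrt t := Real.sqrt_nonneg t
  have hθ : (1 - ε) * Real.sqrt t ≤ θ (Real.sqrt t) := by
    have h := hC (Real.sqrt t) ht1
    rw [pow_one] at h
    have hCle : C ≤ ε * Real.log (Real.sqrt t) := by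
      rw [div_le_iff₀ hε] at ht2; linarith
    have h3 : C * Real.sqrt t / Real.log (Real.sqrt t) ≤ ε * Real.sqrt t := by
      rw [div_le_iff₀ hlogpos]
      nlinarith
    linarith [(abs_le.1 h).1]
  have h4 := Chebyshev.psi_sub_theta_ge_psi_add_psi_add_psi ht0
  have hsq : t ^ (2 : ℝ)⁻¹ = Real.sqrt t := by rw [Real.sqrt_eq_rpow]; norm_num
  rw [hsq] at h4
  have h5 := Chebyshev.theta_le_psi (Real.sqrt t)
  have h6 : 0 ≤ ψ (t ^ (3 : ℝ)⁻¹) := Chebyshev.psi_nonneg _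
  have h7 : 0 ≤ ψ (t ^ (7 : ℝ)⁻¹) := Chebyshev.psi_nonneg _
  linarith

/-- `ψ(t) − θ(t) ≤ (1 + ε)√t` for all large `t` (`ψ − θ ≤ ψ(√t) + ψ(t^{1/3}) + ψ(t^{1/5})`, the prime number theorem at
`√t`, `ψ − θ ≪ √y`, Chebyshev's bound for the last two); the source's use of `ψ = θ + √x + o(√x)`, (1.9).
[cite: Zhao2025MertensMean, §1.4 (1.9) and §2 (proof of Cor 1)] -/
theorem eventually_psi_sub_theta_le {ε : ℝ} (hε : 0 < ε) :
    ∀ᶠ t : ℝ in atTop, ψ t - θ t ≤ (1 + ε) * Real.sqrt t := by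
  obtain ⟨C, hC0, hC⟩ := Mertens.exists_abs_theta_sub_le_div_log_pow 1
  obtain ⟨C', hC'⟩ := Chebyshev.psi_sub_theta_le_mul_sqrt
  have hC₀pos : 0 < Real.log 4 + 4 := by
    have := Real.log_nonneg (by norm_num : (1 : ℝ) ≤ 4); linarith
  have h1 : ∀ᶠ t : ℝ in atTop, 2 ≤ Real.sqrt t := tendsto_sqrt_atTop.eventually_ge_atTop 2
  have h2 : ∀ᶠ t : ℝ in atTop, 4 * C / ε ≤ Real.log (Real.sqrt t) :=
    (Real.tendsto_log_atTop.comp tendsto_sqrt_atTop).eventually_ge_atTop _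
  have h3 : ∀ᶠ t : ℝ in atTop, 4 * C' / ε ≤ Real.sqrt (Real.sqrt t) :=
    (tendsto_sqrt_atTop.comp tendsto_sqrt_atTop).eventually_ge_atTop _
  have h4 : ∀ᶠ t : ℝ in atTop, 4 * (Real.log 4 + 4) / ε ≤ t ^ (1 / 6 : ℝ) :=
    (tendsto_rpow_atTop (by norm_num : (0 : ℝ) < 1 / 6)).eventually_ge_atTop _
  filter_upwards [h1, h2, h3, h4, eventually_ge_atTop (1 : ℝ)] with t ht1 ht2 ht3 ht4 ht1'
  have ht0 : 0 < t := by linarith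
  set y : ℝ := Real.sqrt t with hy
  have hy0 : 0 ≤ y := Real.sqrt_nonneg t
  have hlogpos : 0 < Real.log y := Real.log_pos (by linarith)
  -- `θ(√t) ≤ (1 + ε/4)√t`
  have hθ : θ y ≤ y + ε / 4 * y := by
    have h := hC y ht1
    rw [pow_one] at h
    have hCle : 4 * C ≤ ε * Real.log y := by
      rw [div_le_iff₀ hε] at ht2; linarith
    have : C * y / Real.log y ≤ ε / 4 * y := by
      rw [div_le_iff₀ hlogpos]
      nlinarith
    linarith [(abs_le.1 h).2]
  -- `ψ(√t) − θ(√t) ≤ C'√√t ≤ (ε/4)√t`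
  have hψθy : ψ y - θ y ≤ ε / 4 * y := by
    have h := hC' y
    have hyy : Real.sqrt y * Real.sqrt y = y := Real.mul_self_sqrt hy0
    have hs0 : 0 ≤ Real.sqrt y := Real.sqrt_nonneg y
    have hC'le : 4 * C' ≤ ε * Real.sqrt y := by
      rw [div_le_iff₀ hε] at ht3; linarith
    have : C' * Real.sqrt y ≤ ε / 4 * y := by nlinarith [hC'le, hs0, hyy]
    linarith
  -- `ψ(t^{1/3}) + ψ(t^{1/5}) ≤ 2(log 4 + 4) t^{1/3} ≤ (ε/2)√t`
  have h13 : ψ (t ^ (3 : ℝ)⁻¹) ≤ (Real.log 4 + 4) * t ^ (1 / 3 : ℝ) := by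
    rw [show (3 : ℝ)⁻¹ = 1 / 3 by norm_num]
    exact Chebyshev.psi_le_const_mul_self (Real.rpow_nonneg ht0.le _)
  have h15 : ψ (t ^ (5 : ℝ)⁻¹) ≤ (Real.log 4 + 4) * t ^ (1 / 3 : ℝ) := by
    rw [show (5 : ℝ)⁻¹ = 1 / 5 by norm_num]
    refine (Chebyshev.psi_le_const_mul_self (Real.rpow_nonneg ht0.le _)).trans ?_
    exact mul_le_mul_of_nonneg_left (Real.rpow_le_rpow_of_exponent_le ht1' (by norm_num)) hC₀pos.le
  have h36 : t ^ (1 / 3 : ℝ) * t ^ (1 / 6 : ℝ) = y := by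
    rw [← Real.rpow_add ht0, hy, Real.sqrt_eq_rpow]; norm_num
  have hsmall : 2 * (Real.log 4 + 4) * t ^ (1 / 3 : ℝ) ≤ ε / 2 * y := by
    rw [← h36]
    have h13pos : 0 ≤ t ^ (1 / 3 : ℝ) := Real.rpow_nonneg ht0.le _
    have : 4 * (Real.log 4 + 4) ≤ ε * t ^ (1 / 6 : ℝ) := by
      rw [div_le_iff₀ hε] at ht4; linarith
    nlinarith
  have hmain := Chebyshev.psi_sub_theta_le_psi_add_psi_add_psi t
  have hsq : t ^ (2 : ℝ)⁻¹ = y := by rw [hy, Real.sqrt_eq_rpow]; norm_num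
  rw [hsq] at hmain
  linarith

/-! ### The two tails under RH -/

/-- `∫_x^∞ (ψ − θ)/t² ≥ 2κ/√x` if `ψ − θ ≥ κ√t` on `[x, ∞)` (`x ≥ 1`). [cite: Zhao2025MertensMean, §2 (display after (2.2))] -/
theorem mul_rpow_le_integral_psi_sub_theta {κ x : ℝ} (hx : 1 ≤ x)
    (h : ∀ t : ℝ, x ≤ t → κ * Real.sqrt t ≤ ψ t - θ t) :
    2 * κ * x ^ (-(1 / 2 : ℝ)) ≤ ∫ t in Ioi x, (ψ t - θ t) / t ^ 2 := by
  have hx0 : 0 < x := by linarith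
  have hval : ∫ t in Ioi x, κ * t ^ (-(3 / 2 : ℝ)) = 2 * κ * x ^ (-(1 / 2 : ℝ)) := by
    rw [integral_const_mul, integral_Ioi_rpow_of_lt (by norm_num) hx0,
      show (-(3 / 2 : ℝ) + 1) = -(1 / 2) by norm_num]
    ring
  rw [← hval]
  refine setIntegral_mono_on ((integrableOn_Ioi_rpow_of_lt (by norm_num : (-(3 / 2 : ℝ)) < -1) hx0).const_mul _)
    (RosserSchoenfeld.integrableOn_psi_sub_theta_div_sq.mono_set (Ioi_subset_Ioi hx))
    measurableSet_Ioi fun t ht => ?_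
  have htx : x < t := ht
  have ht0 : 0 < t := hx0.trans htx
  have hrp : κ * t ^ (-(3 / 2 : ℝ)) = (κ * Real.sqrt t) / t ^ 2 := by
    rw [Real.sqrt_eq_rpow, show (-(3 / 2 : ℝ)) = 1 / 2 - 2 by norm_num, Real.rpow_sub ht0, Real.rpow_two]
    ring
  rw [hrp]
  exact div_le_div_of_nonneg_right (h t htx.le) (by positivity)

/-- `∫_x^∞ (ψ − θ)/t² ≤ 2κ/√x` if `ψ − θ ≤ κ√t` on `[x, ∞)` (`x ≥ 1`). [cite: Zhao2025MertensMean, §2 (proof of Cor 1)] -/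
theorem integral_psi_sub_theta_le_mul_rpow {κ x : ℝ} (hx : 1 ≤ x)
    (h : ∀ t : ℝ, x ≤ t → ψ t - θ t ≤ κ * Real.sqrt t) :
    ∫ t in Ioi x, (ψ t - θ t) / t ^ 2 ≤ 2 * κ * x ^ (-(1 / 2 : ℝ)) := by
  have hx0 : 0 < x := by linarith
  have hval : ∫ t in Ioi x, κ * t ^ (-(3 / 2 : ℝ)) = 2 * κ * x ^ (-(1 / 2 : ℝ)) := by
    rw [integral_const_mul, integral_Ioi_rpow_of_lt (by norm_num) hx0,
      show (-(3 / 2 : ℝ) + 1) = -(1 / 2) by norm_num]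
    ring
  rw [← hval]
  refine setIntegral_mono_on (RosserSchoenfeld.integrableOn_psi_sub_theta_div_sq.mono_set (Ioi_subset_Ioi hx))
    ((integrableOn_Ioi_rpow_of_lt (by norm_num : (-(3 / 2 : ℝ)) < -1) hx0).const_mul _)
    measurableSet_Ioi fun t ht => ?_
  have htx : x < t := ht
  have ht0 : 0 < t := hx0.trans htx
  have hrp : κ * t ^ (-(3 / 2 : ℝ)) = (κ * Real.sqrt t) / t ^ 2 := by
    rw [Real.sqrt_eq_rpow, show (-(3 / 2 : ℝ)) = 1 / 2 - 2 by norm_num, Real.rpow_sub ht0, Real.rpow_two]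
    ring
  rw [hrp]
  exact div_le_div_of_nonneg_right (h t htx.le) (by positivity)

/-- The splitting `∫_y^∞ (θ − t)/t² = ∫_y^∞ (ψ − t)/t² − ∫_y^∞ (ψ − θ)/t²` (`y ≥ 1`).
[cite: Zhao2025MertensMean, §2 (display after (2.2))] -/
theorem tail_eq_psi_sub {y : ℝ} (hy : 1 ≤ y) :
    ∫ t in Ioi y, (θ t - t) / t ^ 2 =
      (∫ t in Ioi y, (ψ t - t) / t ^ 2) - ∫ t in Ioi y, (ψ t - θ t) / t ^ 2 := by
  rw [← integral_sub (RosserSchoenfeld.integrableOn_psi_sub_self_div_sq.mono_set (Ioi_subset_Ioi hy))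
    (RosserSchoenfeld.integrableOn_psi_sub_theta_div_sq.mono_set (Ioi_subset_Ioi hy))]
  refine setIntegral_congr_fun measurableSet_Ioi fun t _ => ?_
  ring

/-- **Under RH, `y T(y) ≤ (B₁ − 2κ)√y + 1`** when `ψ − θ ≥ κ√t` on `[y, ∞)`, `y ≥ 2` (the source's
`∫_X^∞ (θ − x)/x² < (B₁ − 1.96)/√X`). [cite: Zhao2025MertensMean, §2 (display after (2.2))] -/
theorem mul_tail_le_of_RH' (hRH : RiemannHypothesis) {κ y : ℝ} (hy : 2 ≤ y)
    (h : ∀ t : ℝ, y ≤ t → κ * Real.sqrt t ≤ ψ t - θ t) :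
    y * ∫ t in Ioi y, (θ t - t) / t ^ 2 ≤ (nicolasBeta - 2 * κ) * Real.sqrt y + 1 := by
  have hy1 : 1 < y := by linarith
  have hy0 : 0 < y := by linarith
  have h1 := integral_Ioi_psi_sub_self_div_sq_le hy1
  rw [rsK_eq_of_RH hRH hy0] at h1
  have h2 := mul_rpow_le_integral_psi_sub_theta hy1.le h
  have hlog : 0 ≤ Real.log (2 * π) / y :=
    div_nonneg (Real.log_nonneg (by linarith [Real.pi_gt_three])) hy0.le
  have h3 : 1 / (2 * y * (y ^ 2 - 1)) ≤ 1 / y := one_div_le_one_div_of_le hy0 (by nlinarith)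
  have hsqrt : y * y ^ (-(1 / 2 : ℝ)) = Real.sqrt y := by
    have e : y ^ (1 / 2 : ℝ) = y ^ ((1 : ℝ) + -(1 / 2)) := by norm_num
    rw [Real.sqrt_eq_rpow, e, Real.rpow_add hy0, Real.rpow_one]
  rw [tail_eq_psi_sub hy1.le]
  calc y * ((∫ t in Ioi y, (ψ t - t) / t ^ 2) - ∫ t in Ioi y, (ψ t - θ t) / t ^ 2)
      ≤ y * (y ^ (-(1 / 2 : ℝ)) * nicolasBeta + 1 / y - 2 * κ * y ^ (-(1 / 2 : ℝ))) := by
        refine mul_le_mul_of_nonneg_left ?_ hy0.le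
        linarith
    _ = (nicolasBeta - 2 * κ) * (y * y ^ (-(1 / 2 : ℝ))) + 1 := by
        field_simp
        ring
    _ = (nicolasBeta - 2 * κ) * Real.sqrt y + 1 := by rw [hsqrt]

/-- **Under RH, `y T(y) ≥ −(B₁ + 2κ)√y − log 2π`** when `ψ − θ ≤ κ√t` on `[y, ∞)`, `y ≥ 2` (the lower form of
Rosser–Schoenfeld's Lemma 7 and `ψ − θ ≤ κ√t`). [cite: Zhao2025MertensMean, §2 (proof of Cor 1)] -/
theorem neg_mul_tail_le_of_RH (hRH : RiemannHypothesis) {κ y : ℝ} (hy : 2 ≤ y)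
    (h : ∀ t : ℝ, y ≤ t → ψ t - θ t ≤ κ * Real.sqrt t) :
    -((nicolasBeta + 2 * κ) * Real.sqrt y) - Real.log (2 * π) ≤ y * ∫ t in Ioi y, (θ t - t) / t ^ 2 := by
  have hy1 : 1 < y := by linarith
  have hy0 : 0 < y := by linarith
  have h1 := neg_integral_Ioi_psi_sub_self_div_sq_le hy1
  rw [rsK_eq_of_RH hRH hy0] at h1
  have h2 := integral_psi_sub_theta_le_mul_rpow hy1.le h
  have hsqrt : y * y ^ (-(1 / 2 : ℝ)) = Real.sqrt y := by
    have e : y ^ (1 / 2 : ℝ) = y ^ ((1 : ℝ) + -(1 / 2)) := by norm_num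
    rw [Real.sqrt_eq_rpow, e, Real.rpow_add hy0, Real.rpow_one]
  rw [tail_eq_psi_sub hy1.le]
  calc -((nicolasBeta + 2 * κ) * Real.sqrt y) - Real.log (2 * π)
      = -((nicolasBeta + 2 * κ) * (y * y ^ (-(1 / 2 : ℝ)))) - y * (Real.log (2 * π) / y) := by
        rw [hsqrt]; field_simp
    _ = y * (-(y ^ (-(1 / 2 : ℝ)) * nicolasBeta) - Real.log (2 * π) / y - 2 * κ * y ^ (-(1 / 2 : ℝ))) := by
        ring
    _ ≤ y * ((∫ t in Ioi y, (ψ t - t) / t ^ 2) - ∫ t in Ioi y, (ψ t - θ t) / t ^ 2) := by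
        refine mul_le_mul_of_nonneg_left ?_ hy0.le
        linarith

/-! ### The window integral -/

/-- `E₁` is measurable. [cite: Zhao2025MertensMean, §1.1 (definition of E₁)] -/
theorem measurable_E₁ : Measurable E₁ := by
  unfold E₁
  exact (Mertens.measurable_primeLogDivSum.sub Real.measurable_log).sub measurable_const

/-- `E₁` is integrable on every `[a, b] ⊂ [2, ∞)` (it is bounded there). [cite: Zhao2025MertensMean, §1.1 (definition of E₁)] -/
theorem intervalIntegrable_E₁ {a b : ℝ} (ha : 2 ≤ a) (hab : a ≤ b) : IntervalIntegrable E₁ volume a b := by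
  obtain ⟨K, hK⟩ := abs_sum_primesLE_log_div_sub_log_sub_rosserSchoenfeldE_le 0
  rw [intervalIntegrable_iff_integrableOn_Ioc_of_le hab]
  refine Measure.integrableOn_of_bounded (M := K) measure_Ioc_lt_top.ne measurable_E₁.aestronglyMeasurable ?_
  rw [ae_restrict_iff' measurableSet_Ioc]
  refine Eventually.of_forall fun x hx => ?_
  have h := hK x (ha.trans hx.1.le)
  rw [pow_zero, div_one] at h
  rw [Real.norm_eq_abs]
  unfold E₁ Mertens.primeLogDivSum
  exact h

/-- **`∫_{cX}^X E₁ = cX·T(cX) − X·T(X)`** by (2.1) at `X` and at `cX` (`2 ≤ cX ≤ X`).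
[cite: Zhao2025MertensMean, §2 (2.1) and proof of Cor 1] -/
theorem integral_window_E₁_eq {c X : ℝ} (hcX : 2 ≤ c * X) (hc1 : c * X ≤ X) :
    ∫ x in (c * X)..X, E₁ x =
      c * X * (∫ t in Ioi (c * X), (θ t - t) / t ^ 2) - X * ∫ t in Ioi X, (θ t - t) / t ^ 2 := by
  have hX : 2 ≤ X := hcX.trans hc1
  rw [← intervalIntegral.integral_interval_sub_left (intervalIntegrable_E₁ le_rfl hX)
    (intervalIntegrable_E₁ le_rfl hcX), integral_E₁_eq hX, integral_E₁_eq hcX]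
  ring

/-! ### Corollary 1 (`i = 1`) -/

/-- **Zhao 2025, Corollary 1 for `i = 1`, PROVED** (filter form): under RH, for every `0 < c < ((2 − B₁)/(2 + B₁))²`,
`∫_{cX}^X E₁(x) dx > 0` for all large `X` — indeed `≥ (D/2)√X − (1 + log 2π)` with `D = (2 − B₁) − (2 + B₁)√c > 0`
(`B₁ = nicolasBeta`). [cite: Zhao2025MertensMean, Cor 1 (i = 1)] -/
theorem eventually_integral_window_E₁_pos_of_RH (hRH : RiemannHypothesis) {c : ℝ} (hc0 : 0 < c)
    (hc : c < ((2 - nicolasBeta) / (2 + nicolasBeta)) ^ 2) :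
    ∀ᶠ X : ℝ in atTop, 0 < ∫ x in (c * X)..X, E₁ x := by
  have hβ0 : 0 < nicolasBeta := by linarith [nicolasBeta_gt]
  have hβ2 : nicolasBeta < 2 := by linarith [nicolasBeta_lt']
  have hq0 : 0 ≤ (2 - nicolasBeta) / (2 + nicolasBeta) := div_nonneg (by linarith) (by linarith)
  have hq1 : (2 - nicolasBeta) / (2 + nicolasBeta) ≤ 1 := by
    rw [div_le_one (by linarith)]; linarith
  have hc1 : c < 1 := lt_of_lt_of_le hc (by nlinarith)
  obtain ⟨r, hr⟩ : ∃ r : ℝ, r = Real.sqrt c := ⟨_, rfl⟩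
  have hr0 : 0 < r := by rw [hr]; exact Real.sqrt_pos.2 hc0
  have hrlt : r < (2 - nicolasBeta) / (2 + nicolasBeta) := by
    rw [hr, ← Real.sqrt_sq hq0]
    exact Real.sqrt_lt_sqrt hc0.le hc
  obtain ⟨D, hD⟩ : ∃ D : ℝ, D = (2 - nicolasBeta) - (2 + nicolasBeta) * r := ⟨_, rfl⟩
  have hDpos : 0 < D := by
    have : r * (2 + nicolasBeta) < 2 - nicolasBeta := by rwa [lt_div_iff₀ (by linarith)] at hrlt
    rw [hD]; linarith
  obtain ⟨ε, hε⟩ : ∃ ε : ℝ, ε = D / (4 * (1 + r)) := ⟨_, rfl⟩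
  have hεpos : 0 < ε := by rw [hε]; positivity
  have hεD : ε * (2 + 2 * r) = D / 2 := by
    rw [hε]; field_simp; ring
  -- thresholds for `ψ − θ`
  obtain ⟨T₁, hT₁⟩ := (eventually_le_psi_sub_theta hεpos).exists_forall_of_atTop
  obtain ⟨T₂, hT₂⟩ := (eventually_psi_sub_theta_le hεpos).exists_forall_of_atTop
  obtain ⟨X₂, hX₂⟩ : ∃ X₂ : ℝ, X₂ = max (max T₁ T₂) 2 := ⟨_, rfl⟩
  have hX₂2 : 2 ≤ X₂ := by rw [hX₂]; exact le_max_right _ _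
  have hX₂1 : T₁ ≤ X₂ := by rw [hX₂]; exact (le_max_left _ _).trans (le_max_left _ _)
  have hX₂2' : T₂ ≤ X₂ := by rw [hX₂]; exact (le_max_right _ _).trans (le_max_left _ _)
  have hlow : ∀ t : ℝ, X₂ ≤ t → (1 - ε) * Real.sqrt t ≤ ψ t - θ t := fun t ht => hT₁ t (hX₂1.trans ht)
  have hup : ∀ t : ℝ, X₂ ≤ t → ψ t - θ t ≤ (1 + ε) * Real.sqrt t := fun t ht => hT₂ t (hX₂2'.trans ht)
  have hLpos : 0 < 1 + Real.log (2 * π) := by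
    have := Real.log_nonneg (by linarith [Real.pi_gt_three] : (1 : ℝ) ≤ 2 * π); linarith
  filter_upwards [eventually_ge_atTop (X₂ / c), eventually_ge_atTop X₂,
    eventually_gt_atTop ((2 * (1 + Real.log (2 * π)) / D) ^ 2)] with X hX1 hX2 hX3
  have hcX : X₂ ≤ c * X := by
    rw [div_le_iff₀ hc0] at hX1; linarith
  have hX0 : 0 < X := by linarith
  have hcXX : c * X ≤ X := by nlinarith
  rw [integral_window_E₁_eq (hX₂2.trans hcX) hcXX]
  have hA := neg_mul_tail_le_of_RH hRH (κ := 1 + ε) (hX₂2.trans hcX) (fun t ht => hup t (hcX.trans ht))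
  have hB := mul_tail_le_of_RH' hRH (κ := 1 - ε) (hX₂2.trans hX2) (fun t ht => hlow t (hX2.trans ht))
  have hsq : Real.sqrt (c * X) = r * Real.sqrt X := by rw [hr, Real.sqrt_mul hc0.le]
  rw [hsq] at hA
  -- `√X > 2(1 + log 2π)/D`
  have hsX : 2 * (1 + Real.log (2 * π)) / D < Real.sqrt X := by
    rw [← Real.sqrt_sq (by positivity : 0 ≤ 2 * (1 + Real.log (2 * π)) / D)]
    exact Real.sqrt_lt_sqrt (sq_nonneg _) hX3
  have hsX' : 2 * (1 + Real.log (2 * π)) < Real.sqrt X * D := by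
    rwa [div_lt_iff₀ hDpos] at hsX
  -- the coefficient of `√X` is `D − ε(2 + 2r) = D/2`
  have e : -((nicolasBeta + 2 * (1 + ε)) * (r * Real.sqrt X)) - Real.log (2 * π) -
      ((nicolasBeta - 2 * (1 - ε)) * Real.sqrt X + 1) = D / 2 * Real.sqrt X - (1 + Real.log (2 * π)) := by
    linear_combination (-Real.sqrt X) * hD - Real.sqrt X * hεD
  have key : D / 2 * Real.sqrt X - (1 + Real.log (2 * π)) ≤
      c * X * (∫ t in Ioi (c * X), (θ t - t) / t ^ 2) - X * ∫ t in Ioi X, (θ t - t) / t ^ 2 := by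
    rw [← e]; linarith
  linarith

/-- **Zhao 2025, Corollary 1 for `i = 1`, PROVED** in the shape of the named fact `Zhao2025MertensMean_cor1` (first conjunct,
`B₁ = 2 + γ − log 4π`): assuming RH, for every `0 < c < ((2 − B₁)/(2 + B₁))²` there is `X₀` with `∫_{cX}^X E₁(x) dx > 0`
for all `X ≥ X₀`. [cite: Zhao2025MertensMean, Cor 1 (i = 1)] -/
theorem cor1_E₁_of_RH (hRH : RiemannHypothesis) {c : ℝ} (hc0 : 0 < c)
    (hc : c < ((2 - (2 + Real.eulerMascheroniConstant - Real.log (4 * π))) /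
      (2 + (2 + Real.eulerMascheroniConstant - Real.log (4 * π)))) ^ 2) :
    ∃ X₀ : ℝ, ∀ X : ℝ, X₀ ≤ X → 0 < ∫ x in (c * X)..X, E₁ x := by
  -- `B₁ = 2 + γ − log 4π = nicolasBeta` (also the tree's `BCF.nicolasBeta_eq`, not imported here)
  have hβ : nicolasBeta = 2 + Real.eulerMascheroniConstant - Real.log (4 * π) := by
    rw [nicolasBeta, show (4 : ℝ) * π = 2 ^ 2 * π by norm_num, Real.log_mul (by positivity) Real.pi_pos.ne',
      Real.log_pow]
    push_cast
    ring
  rw [← hβ] at hc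
  exact (eventually_integral_window_E₁_pos_of_RH hRH hc0 hc).exists_forall_of_atTop

end Zhao2025

end Literature.NumberTheory.LFunctions
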